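import Literature.Probability.RandomPlanarGeometry.SAWStripPolygonStrict
import HarnessLib

/-!
# Polygons in a planar strip are slower than walks in the next thinner strip: `μ_Polygon(S_T) ≤ μ(S_{T-1})`
# (Madras–Slade Theorem 8.2.2 (b) sharpened; topological shielding from both walls)

Topic `Literature/Probability/RandomPlanarGeometry` (continues `SAWStripPolygonStrict.lean`: the planar lemma
`StripPolygonStrict.exists_mem_support_of_feet`, cyclic polygons `StripPolygonStrict.CycSAP`, the codes
`topPair`/`topRel`/`assemble`, `MadrasSlade1993_thm822b_strip : π(S_T) < μ(S_T)`; `SAWTubePolygons.lean`: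
`q̃_N(R) = Zd.tubePolygonCount`, `π(R) = Zd.tubePolygonRate`; `SAWTubeCount.lean`: `c_N(R) = Zd.tubeCount`,
`μ(R) = Zd.tubeConnectiveConstant`; `SAWTubeMonotonicity.lean`: (8.2.13); the planar crossing lemma
`Percolation.exists_mem_support_of_crossing`).

Source: N. Madras, G. Slade, *The Self-Avoiding Walk* (Birkhäuser 1993), §8.2, Theorem 8.2.2 (b) (book p. 271):
"If `k = 1`, then `μ_Polygon(R) < μ(R)`" (printed proof: outline via the tube pattern theorem of Soteros–Whittington
1989; attribution Notes §8.5 p. 278: Soteros–Whittington 1988, Alm–Janson 1990). This file proves, for the planar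
strips `S_T = R[1,T] = ℤ × {0,…,T}` (`d = 2`, `k = 1`), the SHARPER inequality

  **`π(S_T) ≤ μ(S_{T-1})`** for every `T ≥ 1` (`Zd.tubePolygonRate_le_tubeConnectiveConstant_pred`),

i.e. self-avoiding polygons in the strip of height `T` grow no faster than self-avoiding WALKS in the strip of height
`T - 1`; with the strict monotonicity (8.2.13) `μ(S_{T-1}) < μ(S_T)` (Kesten-free in this tree) this gives Theorem
8.2.2 (b) for `d = 2` (`MadrasSlade1993_thm822b_strip` of the parent file) with the deficit `log μ(S_T) - log π(S_T) ≥ log μ(S_T) - log μ(S_{T-1})` (the full monotonicity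
gap; `Zd.log_tubeConnectiveConstant_sub_log_tubePolygonRate_ge_gap`), improving the factor `1/(T+2)` of
`SAWStripPolygonStrict.lean`. Numerically (Guttmann–Jensen, LNP 775 ch. 10, Table 10.1, pp. 237–238: `π(S_2) = √2`,
`π(S_3) = 1.6818`, `π(S_4) = 1.8631`, …) against `μ(S_1) = (1+√5)/2`, `μ(S_2) ≈ 1.92`, `μ(S_3) ≈ 2.12` the inequality holds
with room. Label (lane literature cell, 2026-08-23): NOT LOCATED IN HELD PRINT — a planar sharpening of the printed
qualitative Theorem 8.2.2 (b); the shielding MECHANISM is printed as prose for interacting polygons in slits ("topology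
prevents the top of the polygon reaching the bottom wall (and vice versa)", LNP 775 ch. 10, §10.3, p. 241, after
Alvarez–Janse van Rensburg–Soteros–Whittington, J. Phys. A 41 (2008) 185004), without a counting inequality or a growth-rate
comparison; the primaries Soteros–Whittington 1988 and Alm–Janson 1990 are not held by the lane. Scope: planar strips only
(`d = 2`, `k = 1`); for slabs `k ≥ 2` polygons and walks have the SAME connective constant (Theorem 8.2.2 (c),
`MadrasSlade1993_thm822c` / `SAWSlabPolygonGrowth.lean`), and tubes `k = 1`, `d ≥ 3` are not planar.

## The argument (topological shielding from BOTH walls)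

Let `P` be an `N`-step self-avoiding polygon of `S_T` with column range `[c, c']` (`c < c'`), split at a vertex `u`
of the column `c` and a vertex `v` of the column `c'` into two arcs. CLAIM: no arc has interior vertices on BOTH walls
(the floor `x₁ = 0` and the ceiling `x₁ = T`). Indeed the sub-arc between a floor vertex and a ceiling vertex of one
arc is a top–bottom crossing of the box `[c, c'] × [0, T]`, the other arc is a left–right crossing, so they share a
vertex (`exists_mem_support_of_crossing`) — which would be a common vertex of the two arcs other than `u`, `v`. Hence
EACH arc keeps off one wall in its interior: stripped of its two end-edges it is a walk of a strip of height `T - 1`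
(rows `1..T` or rows `0..T-1`). Recording (root index, root height, for each arc: the wall bit, the two end-steps,
the interior as an element of `tubePairs 2 1 (T-1) (ℓ-2)`) is injective, so
`q̃_N(S_T) ≤ 26244 (T+1) N Σ_ℓ c_{ℓ-2}(S_{T-1}) c_{N-ℓ-2}(S_{T-1})` (`tubePolygonCount_le_sum_pred`), and the envelope
`c_n(S_{T-1}) ≤ D ρ^n` (`ρ > μ(S_{T-1})`) gives `π(S_T) ≤ ρ`, hence `π(S_T) ≤ μ(S_{T-1})`.

## References

* N. Madras, G. Slade, *The Self-Avoiding Walk*, Birkhäuser (1993), §8.2, Theorem 8.2.2 (b), p. 271; Theorem 8.2.1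
  (8.2.13), p. 269; Notes §8.5, p. 278. [MadrasSlade1993]
* C. E. Soteros, S. G. Whittington, J. Phys. A 21 (1988) L857–L861. [SoterosWhittington1988]
* S. E. Alm, S. Janson, Commun. Statist. Stochastic Models 6 (1990) 169–212. [AlmJanson1990]
* A. J. Guttmann, I. Jensen, *The effect of confinement*, in *Polygons, Polyominoes and Polycubes*, LNP 775 (2009),
  ch. 10, §10.1 pp. 235–236, Table 10.1 pp. 237–238, §10.3 p. 241. [GuttmannJensen2009Confinement]
-/

noncomputable section

open Filter Topology Literature.Probability.LatticeModels Literature.Probability.Percolation SimpleGraph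
open scoped BigOperators

namespace Literature.Probability.RandomPlanarGeometry.SAW.Zd

namespace StripPolygonWall

open StripPolygonStrict StripPolygonStrict.CycSAP

variable {N : ℕ} {W : ℕ → Site 2}

/-! ### Cyclic polygons: the elementary bookkeeping (re-proved; private in `SAWStripPolygonStrict.lean`) -/

/-- Values only depend on the index modulo `N`. [folklore] -/
private theorem c_apply_mod (h : CycSAP N W) (m : ℕ) : W (m % N) = W m := by
  have key : ∀ q r, W (r + N * q) = W r := by
    intro q
    induction q with
    | zero => intro r; simp
    | succ q ih => intro r; rw [Nat.mul_succ, ← add_assoc, h.periodic, ih]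
  conv_rhs => rw [← Nat.mod_add_div m N]
  exact (key (m / N) (m % N)).symm

/-- `W N = W 0`. [folklore] -/
private theorem c_apply_N (h : CycSAP N W) : W N = W 0 := by
  have := h.periodic 0; rwa [zero_add] at this

/-- `0 < N`. [folklore] -/
private theorem c_pos (h : CycSAP N W) : 0 < N := by have := h.three_le; omega

/-- Equal values have equal indices modulo `N`. [folklore] -/
private theorem c_mod_eq_of_eq (h : CycSAP N W) {m m' : ℕ} (hm : W m = W m') : m % N = m' % N :=
  h.injOn (Nat.mod_lt _ (c_pos h)) (Nat.mod_lt _ (c_pos h)) (by rw [(c_apply_mod h), (c_apply_mod h), hm])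

/-- Re-rooting a cyclic polygon. [folklore] -/
private theorem c_shift (h : CycSAP N W) (t : ℕ) : CycSAP N (fun m => W (t + m)) where
  three_le := h.three_le
  adj m := by rw [← add_assoc]; exact h.adj (t + m)
  periodic m := by show W (t + (m + N)) = W (t + m); rw [← add_assoc, h.periodic]
  injOn := by
    intro m hm m' hm' hmm'
    simp only [Set.mem_setOf_eq] at hm hm' hmm'
    have h1 := (c_mod_eq_of_eq h) hmm'
    by_contra hne
    rcases Nat.lt_or_gt_of_ne hne with hlt | hlt
    · have h2 := Nat.sub_mod_eq_zero_of_mod_eq h1.symm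
      rw [Nat.add_sub_add_left, Nat.mod_eq_of_lt (by omega)] at h2
      omega
    · have h2 := Nat.sub_mod_eq_zero_of_mod_eq h1
      rw [Nat.add_sub_add_left, Nat.mod_eq_of_lt (by omega)] at h2
      omega


/-- The vertices of `segWalk`. [folklore] -/
private theorem c_mem_support_segWalk {hadj : ∀ m, (zdGraph 2).Adj (W m) (W (m + 1))} {s n : ℕ} {z : Site 2} :
    z ∈ (segWalk W hadj s n).support ↔ ∃ r, r ≤ n ∧ W (s + r) = z := by
  induction n with
  | zero =>
    show z ∈ (Walk.nil : (zdGraph 2).Walk (W s) (W s)).support ↔ _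
    rw [Walk.support_nil, List.mem_singleton]
    constructor
    · rintro rfl; exact ⟨0, le_rfl, rfl⟩
    · rintro ⟨r, hr, rfl⟩; obtain rfl : r = 0 := by omega
      rfl
  | succ n ih =>
    show z ∈ ((segWalk W hadj s n).concat (hadj (s + n))).support ↔ _
    rw [Walk.support_concat, List.mem_append, List.mem_singleton, ih]
    constructor
    · rintro (⟨r, hr, hrz⟩ | rfl)
      · exact ⟨r, by omega, hrz⟩
      · exact ⟨n + 1, le_rfl, rfl⟩
    · rintro ⟨r, hr, hrz⟩
      rcases Nat.lt_or_ge r (n + 1) with hr' | hr'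
      · exact Or.inl ⟨r, by omega, hrz⟩
      · obtain rfl : r = n + 1 := le_antisymm hr hr'
        exact Or.inr hrz.symm


/-- Every vertex lies in a column `≥ cmin`. [folklore] -/
private theorem c_cmin_le (h : CycSAP N W) (m : ℕ) : cmin N W ≤ W m 0 := by
  rw [← (c_apply_mod h) m]
  have hm : W (m % N) 0 ∈ (Finset.range (N + 1)).image (fun m => W m 0) :=
    Finset.mem_image.2 ⟨m % N, Finset.mem_range.2 (by have := Nat.mod_lt m (c_pos h); omega), rfl⟩
  exact Finset.min'_le _ _ hm

/-- Every vertex lies in a column `≤ cmax`. [folklore] -/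
private theorem c_le_cmax (h : CycSAP N W) (m : ℕ) : W m 0 ≤ cmax N W := by
  rw [← (c_apply_mod h) m]
  have hm : W (m % N) 0 ∈ (Finset.range (N + 1)).image (fun m => W m 0) :=
    Finset.mem_image.2 ⟨m % N, Finset.mem_range.2 (by have := Nat.mod_lt m (c_pos h); omega), rfl⟩
  exact Finset.le_max' _ _ hm

/-- The leftmost column is attained at an index `< N`. [folklore] -/
private theorem c_exists_eq_cmin (h : CycSAP N W) : ∃ m, m < N ∧ W m 0 = cmin N W := by
  obtain ⟨m, hm, hmeq⟩ := Finset.mem_image.1 (Finset.min'_mem ((Finset.range (N + 1)).image fun m => W m 0) (by simp))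
  refine ⟨m % N, Nat.mod_lt _ (c_pos h), ?_⟩
  rw [(c_apply_mod h)]; exact hmeq

/-- The rightmost column is attained at an index `< N`. [folklore] -/
private theorem c_exists_eq_cmax (h : CycSAP N W) : ∃ m, m < N ∧ W m 0 = cmax N W := by
  obtain ⟨m, hm, hmeq⟩ := Finset.mem_image.1 (Finset.max'_mem ((Finset.range (N + 1)).image fun m => W m 0) (by simp))
  refine ⟨m % N, Nat.mod_lt _ (c_pos h), ?_⟩
  rw [(c_apply_mod h)]; exact hmeq

/-- Consecutive vertices in the same column differ by `±1` in height; in different columns they have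
the same height and columns differing by `±1`. [folklore] -/
private theorem c_step_cases (h : CycSAP N W) (m : ℕ) :
    (W (m + 1) 0 = W m 0 ∧ (W (m + 1) 1 = W m 1 + 1 ∨ W (m + 1) 1 + 1 = W m 1)) ∨
      (W (m + 1) 1 = W m 1 ∧ (W (m + 1) 0 = W m 0 + 1 ∨ W (m + 1) 0 + 1 = W m 0)) := by
  rcases stepKind_of_adj (h.adj m) with ⟨h0, h1⟩ | ⟨h0, h1⟩ | ⟨h1, h0⟩ | ⟨h1, h0⟩
  · exact Or.inr ⟨h1, Or.inl h0⟩
  · exact Or.inr ⟨h1, Or.inr h0.symm⟩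
  · exact Or.inl ⟨h0, Or.inl h1⟩
  · exact Or.inl ⟨h0, Or.inr h1.symm⟩

/-- **A polygon occupies at least two columns.** (At a vertex of maximal height in a one-column
polygon both neighbours would coincide.) [folklore] -/
private theorem c_cmin_lt_cmax (h : CycSAP N W) : cmin N W < cmax N W := by
  by_contra hle
  rw [not_lt] at hle
  have hcol : ∀ m, W m 0 = cmin N W := fun m => le_antisymm ((c_le_cmax h m).trans hle) (c_cmin_le h m)
  -- a vertex of maximal height among `W 0, …, W N`
  obtain ⟨m, -, hm⟩ := Finset.exists_max_image (Finset.range (N + 1)) (fun m => W m 1) (by simp)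
  have hmax : ∀ m', W m' 1 ≤ W m 1 := fun m' => by
    rw [← (c_apply_mod h) m']
    exact hm _ (Finset.mem_range.2 (by have := Nat.mod_lt m' (c_pos h); omega))
  -- both neighbours of `W m` are one below it
  have hup : W (m + 1) 1 + 1 = W m 1 := by
    rcases (c_step_cases h) m with ⟨-, h1 | h1⟩ | ⟨-, h0 | h0⟩
    · linarith [hmax (m + 1)]
    · exact h1
    · linarith [hcol m, hcol (m + 1)]
    · linarith [hcol m, hcol (m + 1)]
  have hdn : W (m + N - 1) 1 + 1 = W m 1 := by
    have e : m + N - 1 + 1 = m + N := by have := (c_pos h); omega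
    rcases (c_step_cases h) (m + N - 1) with ⟨-, h1 | h1⟩ | ⟨-, h0 | h0⟩
    · rw [e, h.periodic] at h1; linarith
    · rw [e, h.periodic] at h1; linarith [hmax (m + N - 1)]
    · rw [e, h.periodic] at h0; linarith [hcol m, hcol (m + N - 1)]
    · rw [e, h.periodic] at h0; linarith [hcol m, hcol (m + N - 1)]
  have heq : W (m + 1) = W (m + N - 1) := by
    rw [Site.eq_iff_two]; exact ⟨by rw [hcol, hcol], by linarith⟩
  have h1 := (c_mod_eq_of_eq h) heq
  have h2 := Nat.sub_mod_eq_zero_of_mod_eq h1.symm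
  have h3 : m + N - 1 - (m + 1) = N - 2 := by have := h.three_le; omega
  rw [h3, Nat.mod_eq_of_lt (by have := h.three_le; omega)] at h2
  have := h.three_le; omega


/-- `W` is injective on every window of fewer than `N` consecutive indices. [folklore] -/
private theorem c_injOn_window (h : CycSAP N W) (s : ℕ) {n : ℕ} (hn : n < N) : Set.InjOn W {m | s ≤ m ∧ m ≤ s + n} := by
  intro m hm m' hm' hmm'
  simp only [Set.mem_setOf_eq] at hm hm'
  have h1 := (c_mod_eq_of_eq h) hmm'
  by_contra hne
  rcases Nat.lt_or_gt_of_ne hne with hlt | hlt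
  · have h2 := Nat.sub_mod_eq_zero_of_mod_eq h1.symm
    rw [Nat.mod_eq_of_lt (by omega)] at h2
    omega
  · have h2 := Nat.sub_mod_eq_zero_of_mod_eq h1
    rw [Nat.mod_eq_of_lt (by omega)] at h2
    omega


/-- The stretch `W[s, s + n]` (`n < N`), translated to start at the origin, is an `n`-step self-avoiding
walk. [folklore] -/
private theorem c_piece_mem_saws (h : CycSAP N W) (s : ℕ) {n : ℕ} (hn : n < N) :
    (fun r => W (s + min r n) - W s) ∈ saws 2 n := by
  refine mem_saws.2 ⟨by simp, fun r hr => by simp [min_eq_right hr], fun r hr => ?_, fun r hr r' hr' hrr => ?_⟩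
  · have h1 : min r n = r := min_eq_left hr.le
    have h2 : min (r + 1) n = r + 1 := min_eq_left (by omega)
    simp only [h1, h2]
    rw [zdGraph_adj_sub_right, ← add_assoc]
    exact h.adj (s + r)
  · simp only [Set.mem_setOf_eq] at hr hr'
    simp only [min_eq_left hr, min_eq_left hr', sub_left_inj] at hrr
    have := (c_injOn_window h) s hn ⟨by omega, by omega⟩ ⟨by omega, by omega⟩ hrr
    omega


/-! ### Small vectors, assembling, the top code (re-proved; private in `SAWStripPolygonStrict.lean`) -/

/-- `#dirs = 9`. [folklore] -/
private theorem c_card_dirs : dirs.card = 9 := by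
  rw [dirs, Fintype.card_piFinset]; simp

/-- A lattice step is one of the nine small vectors. [folklore] -/
private theorem c_sub_mem_dirs {x y : Site 2} (h : (zdGraph 2).Adj x y) : y - x ∈ dirs := by
  rw [dirs, Fintype.mem_piFinset]
  intro i
  have := abs_le.1 (abs_sub_le_one_of_adj h i)
  rw [Finset.mem_Icc, Pi.sub_apply]
  exact ⟨this.1, this.2⟩

/-- Assembling two arcs that describe `W` reproduces `W` relative to its root. [folklore] -/
private theorem c_assemble_eq {W : ℕ → Site 2} {f₁ f₂ : ℕ → Site 2} {ℓ₁ ℓ₂ : ℕ}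
    (h₁ : ∀ m, m ≤ ℓ₁ → f₁ m = W m - W 0) (h₂ : ∀ r, r ≤ ℓ₂ → f₂ r = W (ℓ₁ + r) - W ℓ₁)
    {m : ℕ} (hm : m ≤ ℓ₁ + ℓ₂) : assemble f₁ f₂ ℓ₁ m = W m - W 0 := by
  unfold assemble
  split_ifs with h
  · exact h₁ m h
  · rw [h₁ ℓ₁ le_rfl, h₂ (m - ℓ₁) (by omega), Nat.add_sub_cancel' (by omega)]; abel

/-- The top code describes the arc. [folklore] -/
private theorem c_topRel_topPair (s : ℕ) {ℓ : ℕ} (hℓ : 2 ≤ ℓ) {m : ℕ} (hm : m ≤ ℓ) :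
    topRel (W (s + 1) - W s) (W (s + ℓ) - W (s + ℓ - 1)) (topPair W s ℓ).2 ℓ m = W (s + m) - W s := by
  unfold topRel topPair
  split_ifs with h0 h1
  · subst h0; simp
  · have e : min (m - 1) (ℓ - 2) = m - 1 := min_eq_left (by omega)
    simp only [e]
    rw [show s + 1 + (m - 1) = s + m by omega]; abel
  · have e : min (ℓ - 2) (ℓ - 2) = ℓ - 2 := min_self _
    simp only [e]
    obtain rfl : m = ℓ := by omega
    rw [show s + 1 + (m - 2) = s + m - 1 by omega]; abel


/-! ### No arc touches both walls -/

/-- **Shielding from both walls.** Let the polygon be rooted at a vertex `W 0` of its leftmost column, let `W t`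
(`t < N`) lie in its rightmost column, and let all heights lie in `[B, B']`. Then the first arc `W[0, t]` does not
have interior vertices at both heights `B` and `B'`: the sub-arc between them would be a top–bottom crossing of the
box met by the left–right crossing `W[t, N]` away from `W 0`, `W t`.
[cite: MadrasSlade1993, Theorem 8.2.2 (b) (this file's proof: shielding from both walls)] -/
theorem not_floor_and_ceiling_fst (h : CycSAP N W) {B B' : ℤ} (hBB' : B < B') (hlo : ∀ m, B ≤ W m 1) (hhi : ∀ m, W m 1 ≤ B')
    (h0c : W 0 0 = cmin N W) {t : ℕ} (htN : t < N) (htc : W t 0 = cmax N W)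
    {i i' : ℕ} (hi0 : 0 < i) (hit : i < t) (hiB : W i 1 = B) (hi'0 : 0 < i') (hi't : i' < t) (hi'B : W i' 1 = B') :
    False := by
  have hbox : ∀ m, cmin N W ≤ W m 0 ∧ W m 0 ≤ cmax N W ∧ B ≤ W m 1 ∧ W m 1 ≤ B' :=
    fun m => ⟨(c_cmin_le h) m, (c_le_cmax h) m, hlo m, hhi m⟩
  have hsupp : ∀ {s n : ℕ} (z : Site 2), z ∈ (segWalk W h.adj s n).support →
      cmin N W ≤ z 0 ∧ z 0 ≤ cmax N W ∧ B ≤ z 1 ∧ z 1 ≤ B' := by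
    intro s n z hz
    obtain ⟨r, -, rfl⟩ := c_mem_support_segWalk.1 hz
    exact hbox _
  -- the other arc, as a left-right crossing from `W 0` (column `cmin`) to `W t` (column `cmax`)
  have e2 : W (t + (N - t)) = W 0 := by rw [Nat.add_sub_cancel' htN.le, (c_apply_N h)]
  set β := ((segWalk W h.adj t (N - t)).copy rfl e2).reverse with hβ
  have hβs : ∀ z ∈ β.support, cmin N W ≤ z 0 ∧ z 0 ≤ cmax N W ∧ B ≤ z 1 ∧ z 1 ≤ B' := fun z hz => by
    rw [hβ, Walk.support_reverse, List.mem_reverse, Walk.support_copy] at hz; exact hsupp z hz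
  have hβidx : ∀ z ∈ β.support, ∃ r', r' ≤ N - t ∧ W (t + r') = z := fun z hz => by
    rw [hβ, Walk.support_reverse, List.mem_reverse, Walk.support_copy] at hz; exact c_mem_support_segWalk.1 hz
  -- index clash: a vertex of the first arc with index in `[1, t-1]` is not on the second arc
  have hclash : ∀ {k : ℕ}, 0 < k → k < t → ∀ z ∈ β.support, W k ≠ z := by
    intro k hk0 hkt z hz hkz
    obtain ⟨r', hr', hrr⟩ := hβidx z hz
    rw [← hkz] at hrr
    rcases Nat.lt_or_ge (t + r') N with hlt' | hge
    · have := h.injOn (show t + r' < N from hlt') (show k < N by omega) hrr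
      omega
    · have hN : t + r' = N := by omega
      rw [hN, (c_apply_N h)] at hrr
      have := h.injOn (show 0 < N from (c_pos h)) (show k < N by omega) hrr
      omega
  have hii' : i ≠ i' := by rintro rfl; rw [hiB] at hi'B; omega
  rcases lt_or_gt_of_ne hii' with hlt | hgt
  · -- `γ = W[i, i']` from the floor to the ceiling
    have e1 : W (i + (i' - i)) = W i' := by rw [Nat.add_sub_cancel' hlt.le]
    obtain ⟨z, hzβ, hzγ⟩ := exists_mem_support_of_crossing (L := cmin N W) (R := cmax N W) (B := B) (T := B')
      β ((segWalk W h.adj i (i' - i)).copy rfl e1) hβs (fun z hz => hsupp z (by simpa using hz)) h0c htc hiB hi'B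
    rw [Walk.support_copy] at hzγ
    obtain ⟨r, hr, rfl⟩ := c_mem_support_segWalk.1 hzγ
    exact hclash (k := i + r) (by omega) (by omega) _ hzβ rfl
  · -- `γ = W[i', i]` reversed, from the floor to the ceiling
    have e1 : W (i' + (i - i')) = W i := by rw [Nat.add_sub_cancel' hgt.le]
    obtain ⟨z, hzβ, hzγ⟩ := exists_mem_support_of_crossing (L := cmin N W) (R := cmax N W) (B := B) (T := B')
      β ((segWalk W h.adj i' (i - i')).copy rfl e1).reverse hβs
      (fun z hz => hsupp z (by simpa using hz)) h0c htc hiB hi'B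
    rw [Walk.support_reverse, List.mem_reverse, Walk.support_copy] at hzγ
    obtain ⟨r, hr, rfl⟩ := c_mem_support_segWalk.1 hzγ
    exact hclash (k := i' + r) (by omega) (by omega) _ hzβ rfl

/-- **Shielding from both walls, second arc**: the arc `W[t, N]` does not have interior vertices at both heights
`B` and `B'` (the sub-arc between them would meet the left–right crossing `W[0, t]`).
[cite: MadrasSlade1993, Theorem 8.2.2 (b) (this file's proof: shielding from both walls)] -/
theorem not_floor_and_ceiling_snd (h : CycSAP N W) {B B' : ℤ} (hBB' : B < B') (hlo : ∀ m, B ≤ W m 1) (hhi : ∀ m, W m 1 ≤ B')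
    (h0c : W 0 0 = cmin N W) {t : ℕ} (htc : W t 0 = cmax N W)
    {j j' : ℕ} (htj : t < j) (hjN : j < N) (hjB : W j 1 = B) (htj' : t < j') (hj'N : j' < N) (hj'B : W j' 1 = B') :
    False := by
  have hbox : ∀ m, cmin N W ≤ W m 0 ∧ W m 0 ≤ cmax N W ∧ B ≤ W m 1 ∧ W m 1 ≤ B' :=
    fun m => ⟨(c_cmin_le h) m, (c_le_cmax h) m, hlo m, hhi m⟩
  have hsupp : ∀ {s n : ℕ} (z : Site 2), z ∈ (segWalk W h.adj s n).support →
      cmin N W ≤ z 0 ∧ z 0 ≤ cmax N W ∧ B ≤ z 1 ∧ z 1 ≤ B' := by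
    intro s n z hz
    obtain ⟨r, -, rfl⟩ := c_mem_support_segWalk.1 hz
    exact hbox _
  -- the first arc, a left-right crossing from `W 0` to `W t`
  have e2 : W (0 + t) = W t := by rw [zero_add]
  set β := (segWalk W h.adj 0 t).copy rfl e2 with hβ
  have hβs : ∀ z ∈ β.support, cmin N W ≤ z 0 ∧ z 0 ≤ cmax N W ∧ B ≤ z 1 ∧ z 1 ≤ B' := fun z hz => by
    rw [hβ, Walk.support_copy] at hz; exact hsupp z hz
  have hclash : ∀ {k : ℕ}, t < k → k < N → ∀ z ∈ β.support, W k ≠ z := by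
    intro k hk0 hkt z hz hkz
    rw [hβ, Walk.support_copy] at hz
    obtain ⟨r', hr', hrr⟩ := c_mem_support_segWalk.1 hz
    rw [← hkz, zero_add] at hrr
    have := h.injOn (show r' < N by omega) (show k < N from hkt) hrr
    omega
  have hjj' : j ≠ j' := by rintro rfl; rw [hjB] at hj'B; omega
  rcases lt_or_gt_of_ne hjj' with hlt | hgt
  · have e1 : W (j + (j' - j)) = W j' := by rw [Nat.add_sub_cancel' hlt.le]
    obtain ⟨z, hzβ, hzγ⟩ := exists_mem_support_of_crossing (L := cmin N W) (R := cmax N W) (B := B) (T := B')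
      β ((segWalk W h.adj j (j' - j)).copy rfl e1) hβs (fun z hz => hsupp z (by simpa using hz)) h0c htc hjB hj'B
    rw [Walk.support_copy] at hzγ
    obtain ⟨r, hr, rfl⟩ := c_mem_support_segWalk.1 hzγ
    exact hclash (k := j + r) (by omega) (by omega) _ hzβ rfl
  · have e1 : W (j' + (j - j')) = W j := by rw [Nat.add_sub_cancel' hgt.le]
    obtain ⟨z, hzβ, hzγ⟩ := exists_mem_support_of_crossing (L := cmin N W) (R := cmax N W) (B := B) (T := B')
      β ((segWalk W h.adj j' (j - j')).copy rfl e1).reverse hβs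
      (fun z hz => hsupp z (by simpa using hz)) h0c htc hjB hj'B
    rw [Walk.support_reverse, List.mem_reverse, Walk.support_copy] at hzγ
    obtain ⟨r, hr, rfl⟩ := c_mem_support_segWalk.1 hzγ
    exact hclash (k := j' + r) (by omega) (by omega) _ hzβ rfl

/-! ### Codes of arcs keeping off one wall -/

/-- The code of an arc `W[s, s+ℓ]` keeping off a wall: its interior as a walk of `S_{T-1}`, started at
`(0, W(s+1)₁ - 1)` (off the floor, `w = true`) or at `(0, W(s+1)₁)` (off the ceiling); for `ℓ < 2` the empty walk.
[cite: MadrasSlade1993, Theorem 8.2.2 (b) (this file's proof)] -/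
def arcPair (W : ℕ → Site 2) (s ℓ : ℕ) (w : Bool) : Site 2 × (ℕ → Site 2) :=
  if ℓ < 2 then (0, fun _ => 0)
  else (Pi.single 1 (if w then W (s + 1) 1 - 1 else W (s + 1) 1), fun r => W (s + 1 + min r (ℓ - 2)) - W (s + 1))

/-- The last step of an arc (or `0` for a one-step arc). [cite: MadrasSlade1993, Theorem 8.2.2 (b) (this file's proof)] -/
def lastStep (W : ℕ → Site 2) (s ℓ : ℕ) : Site 2 := if ℓ < 2 then 0 else W (s + ℓ) - W (s + ℓ - 1)

/-- `0 ∈ dirs`. [folklore] -/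
private theorem zero_mem_dirs : (0 : Site 2) ∈ dirs := by
  rw [dirs, Fintype.mem_piFinset]; intro i; simp

/-- The last step is a small vector. [folklore] -/
private theorem lastStep_mem (h : CycSAP N W) (s ℓ : ℕ) : lastStep W s ℓ ∈ dirs := by
  unfold lastStep
  split_ifs with hℓ
  · exact zero_mem_dirs
  · have := c_sub_mem_dirs (h.adj (s + ℓ - 1))
    rwa [show s + ℓ - 1 + 1 = s + ℓ by omega] at this

/-- The arc code describes the arc: `topRel` with the first step, the last step and the interior walk reproduces
`W[s, s+ℓ]` relative to `W s` (`1 ≤ ℓ`). [cite: MadrasSlade1993, Theorem 8.2.2 (b) (this file's proof)] -/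
private theorem topRel_arcPair (s : ℕ) {ℓ : ℕ} (hℓ : 1 ≤ ℓ) (w : Bool) {m : ℕ} (hm : m ≤ ℓ) :
    topRel (W (s + 1) - W s) (lastStep W s ℓ) (arcPair W s ℓ w).2 ℓ m = W (s + m) - W s := by
  by_cases hℓ2 : ℓ < 2
  · obtain rfl : ℓ = 1 := by omega
    unfold topRel lastStep arcPair
    rcases Nat.lt_or_ge m 1 with hm0 | hm1
    · obtain rfl : m = 0 := by omega
      simp
    · obtain rfl : m = 1 := by omega
      simp
  · rw [not_lt] at hℓ2
    have e : (arcPair W s ℓ w).2 = (topPair W s ℓ).2 := by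
      unfold arcPair topPair; rw [if_neg (not_lt.2 hℓ2)]
    rw [e, lastStep, if_neg (not_lt.2 hℓ2)]
    exact c_topRel_topPair s hℓ2 hm

/-- **An arc keeping off one wall is a walk of the thinner strip.** If the interior of `W[s, s+ℓ]` (`1 ≤ ℓ ≤ N`) avoids
the floor (`w = true`) or the ceiling (`w = false`), its code lies in `tubePairs 2 1 (T-1) (ℓ-2)`.
[cite: MadrasSlade1993, Theorem 8.2.2 (b) (this file's proof)] -/
theorem arcPair_mem (h : CycSAP N W) {T : ℕ} (hT : 1 ≤ T) (hbox : ∀ m, 0 ≤ W m 1 ∧ W m 1 ≤ T) (s : ℕ) {ℓ : ℕ}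
    (hℓN : ℓ ≤ N) (w : Bool)
    (hw : ∀ r, 0 < r → r < ℓ → (if w then W (s + r) 1 ≠ 0 else W (s + r) 1 ≠ T)) :
    arcPair W s ℓ w ∈ tubePairs 2 1 (T - 1) (ℓ - 2) := by
  by_cases hℓ : ℓ < 2
  · have e : ℓ - 2 = 0 := by omega
    rw [arcPair, if_pos hℓ, e, mem_tubePairs]
    refine ⟨zero_mem_tubeStarts 2 1 (T - 1), mem_saws.2 ⟨rfl, fun i _ => rfl, fun i hi => absurd hi (by omega),
      fun i hi j hj _ => by simp only [Set.mem_setOf_eq] at hi hj; omega⟩, fun m hm => ?_⟩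
    simp only [add_zero]; exact (mem_tubeStarts.1 (zero_mem_tubeStarts 2 1 (T - 1))).1
  · rw [not_lt] at hℓ
    cases w
    · -- off the ceiling: heights `≤ T - 1`, no shift
      have e : arcPair W s ℓ false = (Pi.single 1 (W (s + 1) 1), fun r => W (s + 1 + min r (ℓ - 2)) - W (s + 1)) := by
        unfold arcPair; rw [if_neg (not_lt.2 hℓ)]; simp
      rw [e]
      have hT' : ((T - 1 : ℕ) : ℤ) = (T : ℤ) - 1 := by push_cast [Nat.cast_sub hT]; ring
      have hint' : ∀ r, r ≤ ℓ - 2 → 0 ≤ W (s + 1 + r) 1 ∧ W (s + 1 + r) 1 ≤ (T : ℤ) - 1 := fun r hr => by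
        have h1 := hw (1 + r) (by omega) (by omega)
        simp only [Bool.false_eq_true, if_false] at h1
        rw [← add_assoc] at h1
        have h2 := hbox (s + 1 + r)
        exact ⟨h2.1, by omega⟩
      rw [mem_tubePairs]
      refine ⟨mem_tubeStarts_two_iff.2 ⟨by simp, ?_, ?_⟩, (c_piece_mem_saws h) (s + 1) (by omega),
        fun m hm => inTube_two_iff.2 ?_⟩
      · have := (hint' 0 (Nat.zero_le _)).1; simp only [add_zero] at this; simp; omega
      · have := (hint' 0 (Nat.zero_le _)).2; simp only [add_zero] at this; simp [hT']; omega
      · simp only [min_eq_left hm, Pi.add_apply, Pi.single_eq_same, Pi.sub_apply, hT']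
        have := hint' m hm
        constructor <;> linarith [this.1, this.2]
    · -- off the floor: this is `topPair`
      have e : arcPair W s ℓ true = topPair W s ℓ := by
        unfold arcPair topPair; rw [if_neg (not_lt.2 hℓ)]; simp
      rw [e]
      exact topPair_mem h hT hbox s hℓ hℓN (fun r h1 h2 => by simpa using hw r h1 h2)

/-! ### Codes, decoding, counting -/

/-- The code type: root index, root height, and for each of the two arcs (wall bit, first step, last step), the
length of the first arc and the two interiors. [cite: MadrasSlade1993, Theorem 8.2.2 (b) (this file's proof)] -/
abbrev Code2 : Type :=
  ℕ × ℤ × (Bool × Site 2 × Site 2) × (Bool × Site 2 × Site 2) × (Σ _ : ℕ, (Site 2 × (ℕ → Site 2)) × (Site 2 × (ℕ → Site 2)))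

/-- Decoding a code into a rooted oriented strip polygon. [cite: MadrasSlade1993, Theorem 8.2.2 (b) (this file's proof)] -/
def decode2 (N : ℕ) (c : Code2) : Site 2 × (ℕ → Site 2) :=
  let ℓ := c.2.2.2.2.1
  let R := assemble (topRel c.2.2.1.2.1 c.2.2.1.2.2 c.2.2.2.2.2.1.2 ℓ) (topRel c.2.2.2.1.2.1 c.2.2.2.1.2.2 c.2.2.2.2.2.2.2 (N - ℓ)) ℓ
  let idx : ℕ → ℕ := fun m => (m + N - c.1) % N
  (Pi.single 1 (c.2.1 + R (idx 0) 1), fun m => R (idx (min m (N - 1))) - R (idx 0))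

/-- The admissible codes at length `N` in the strip of height `T`: both interiors are walks of `S_{T-1}`.
[cite: MadrasSlade1993, Theorem 8.2.2 (b) (this file's proof)] -/
def codes2 (T N : ℕ) : Finset Code2 :=
  (Finset.range N) ×ˢ (Finset.Icc (0 : ℤ) T ×ˢ ((Finset.univ ×ˢ (dirs ×ˢ dirs)) ×ˢ ((Finset.univ ×ˢ (dirs ×ˢ dirs)) ×ˢ
    ((Finset.range (N + 1)).sigma fun ℓ => tubePairs 2 1 (T - 1) (ℓ - 2) ×ˢ tubePairs 2 1 (T - 1) (N - ℓ - 2)))))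

/-- The number of codes. [folklore] -/
private theorem card_codes2 (T N : ℕ) :
    (codes2 T N).card = N * ((T + 1) * ((2 * (9 * 9)) * ((2 * (9 * 9)) *
      ∑ ℓ ∈ Finset.range (N + 1), tubeCount 2 1 (T - 1) (ℓ - 2) * tubeCount 2 1 (T - 1) (N - ℓ - 2)))) := by
  simp only [codes2, Finset.card_product, Finset.card_sigma, Finset.card_range, Finset.card_univ, Fintype.card_bool,
    Int.card_Icc, c_card_dirs, tubeCount]
  have e : ((T : ℤ) + 1 - 0).toNat = T + 1 := by
    rw [sub_zero, show ((T : ℤ) + 1) = ((T + 1 : ℕ) : ℤ) by push_cast; ring, Int.toNat_natCast]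
  rw [e]

/-- **Every rooted oriented `N`-step polygon of `S_T` (`T ≥ 1`) is decoded from an admissible code.**
[cite: MadrasSlade1993, Theorem 8.2.2 (b) (this file's proof)] -/
theorem exists_code2 {T N : ℕ} (hT : 1 ≤ T) {p : Site 2 × (ℕ → Site 2)} (hp : p ∈ tubePolygonPairs 2 1 T N) :
    ∃ c ∈ codes2 T N, decode2 N c = p := by
  obtain ⟨hV, hVbox, hV0⟩ := cycSAP_cyc hp
  set V := cyc N p with hVdef
  obtain ⟨tu, htu, htuc⟩ := (c_exists_eq_cmin hV)
  set W : ℕ → Site 2 := fun m => V (tu + m) with hWdef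
  have hW : CycSAP N W := (c_shift hV) tu
  have hWbox : ∀ m, 0 ≤ W m 1 ∧ W m 1 ≤ T := fun m => hVbox (tu + m)
  have h0c : W 0 0 = CycSAP.cmin N W := by
    refine le_antisymm ?_ (c_cmin_le hW 0)
    obtain ⟨m₀, -, hm₀⟩ := (c_exists_eq_cmin hW)
    rw [← hm₀]
    show V (tu + 0) 0 ≤ V (tu + m₀) 0
    rw [add_zero, htuc]; exact (c_cmin_le hV) _
  obtain ⟨tv, htvN, htvc⟩ := (c_exists_eq_cmax hW)
  have htv0 : 0 < tv := by
    rcases Nat.eq_zero_or_pos tv with rfl | hpos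
    · have := (c_cmin_lt_cmax hW); rw [← h0c, ← htvc] at this; exact absurd this (lt_irrefl _)
    · exact hpos
  have hidx : ∀ m, W ((m + N - tu) % N) = V m := fun m => by
    show V (tu + (m + N - tu) % N) = V m
    rw [← (c_apply_mod hV) (tu + (m + N - tu) % N), Nat.add_mod, Nat.mod_mod, ← Nat.add_mod,
      show tu + (m + N - tu) = m + N by omega, (c_apply_mod hV), hV.periodic]
  have hp' := hp
  unfold tubePolygonPairs at hp'
  rw [Finset.mem_filter, mem_tubePairs] at hp'
  obtain ⟨⟨ha, hυ, -⟩, hN3, -⟩ := hp'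
  obtain ⟨hυ0, hυend, -, -⟩ := mem_saws.1 hυ
  have ha0 : p.1 0 = 0 := (mem_tubeStarts_two_iff.1 ha).1
  -- the wall bits: `true` = the arc keeps off the floor
  have hw1 : ∃ w : Bool, ∀ r, 0 < r → r < tv → (if w then W (0 + r) 1 ≠ 0 else W (0 + r) 1 ≠ (T : ℤ)) := by
    by_cases hfl : ∃ i, 0 < i ∧ i < tv ∧ W i 1 = 0
    · obtain ⟨i, hi0, hit, hiB⟩ := hfl
      refine ⟨false, fun r hr0 hr hrT => ?_⟩
      rw [zero_add] at hrT
      exact not_floor_and_ceiling_fst hW (by exact_mod_cast hT) (fun m => (hWbox m).1) (fun m => (hWbox m).2) h0c htvN htvc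
        hi0 hit hiB hr0 hr hrT
    · push Not at hfl
      exact ⟨true, fun r hr0 hr => by rw [zero_add]; exact hfl r hr0 hr⟩
  have hw2 : ∃ w : Bool, ∀ r, 0 < r → r < N - tv → (if w then W (tv + r) 1 ≠ 0 else W (tv + r) 1 ≠ (T : ℤ)) := by
    by_cases hfl : ∃ j, tv < j ∧ j < N ∧ W j 1 = 0
    · obtain ⟨j, htj, hjN, hjB⟩ := hfl
      refine ⟨false, fun r hr0 hr hrT => ?_⟩
      exact not_floor_and_ceiling_snd hW (by exact_mod_cast hT) (fun m => (hWbox m).1) (fun m => (hWbox m).2) h0c htvc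
        htj hjN hjB (by omega) (by omega) hrT
    · push Not at hfl
      exact ⟨true, fun r hr0 hr => hfl (tv + r) (by omega) (by omega)⟩
  obtain ⟨w1, hw1⟩ := hw1
  obtain ⟨w2, hw2⟩ := hw2
  have hw1' : ∀ r, 0 < r → r < tv → (if w1 then W (0 + r) 1 ≠ 0 else W (0 + r) 1 ≠ (T : ℤ)) := hw1
  refine ⟨(tu, W 0 1, (w1, W 1 - W 0, lastStep W 0 tv), (w2, W (tv + 1) - W tv, lastStep W tv (N - tv)),
    ⟨tv, (arcPair W 0 tv w1, arcPair W tv (N - tv) w2)⟩), ?_, ?_⟩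
  · -- membership
    simp only [codes2, Finset.mem_product, Finset.mem_range, Finset.mem_univ, Finset.mem_Icc, Finset.mem_sigma,
      true_and]
    refine ⟨htu, ⟨(hWbox 0).1, (hWbox 0).2⟩, ⟨by simpa using c_sub_mem_dirs (hW.adj 0), lastStep_mem hW 0 tv⟩,
      ⟨c_sub_mem_dirs (hW.adj tv), lastStep_mem hW tv (N - tv)⟩, by omega, ?_, ?_⟩
    · exact arcPair_mem hW hT hWbox 0 htvN.le w1 hw1'
    · exact arcPair_mem hW hT hWbox tv (by omega) w2 hw2
  · -- decoding
    have hR : ∀ m, m ≤ N → assemble (topRel (W 1 - W 0) (lastStep W 0 tv) (arcPair W 0 tv w1).2 tv)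
        (topRel (W (tv + 1) - W tv) (lastStep W tv (N - tv)) (arcPair W tv (N - tv) w2).2 (N - tv)) tv m =
        W m - W 0 := fun m hm => by
      refine c_assemble_eq (ℓ₂ := N - tv) (fun m' hm' => ?_) (fun r hr => topRel_arcPair tv (by omega) w2 hr) (by omega)
      have := topRel_arcPair (W := W) 0 htv0 w1 hm'
      simp only [zero_add] at this
      exact this
    have hRi : ∀ m, assemble (topRel (W 1 - W 0) (lastStep W 0 tv) (arcPair W 0 tv w1).2 tv)
        (topRel (W (tv + 1) - W tv) (lastStep W tv (N - tv)) (arcPair W tv (N - tv) w2).2 (N - tv)) tv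
        ((m + N - tu) % N) = V m - W 0 := fun m => by
      rw [hR _ (Nat.mod_lt _ (c_pos hV)).le, hidx]
    obtain ⟨a, υ⟩ := p
    simp only [decode2]
    refine Prod.ext ?_ (funext fun m => ?_)
    · show (Pi.single 1 (W 0 1 + assemble (topRel (W 1 - W 0) (lastStep W 0 tv) (arcPair W 0 tv w1).2 tv)
        (topRel (W (tv + 1) - W tv) (lastStep W tv (N - tv)) (arcPair W tv (N - tv) w2).2 (N - tv)) tv
        ((0 + N - tu) % N) 1) : Site 2) = a
      rw [hRi, Site.eq_iff_two]
      simp only [Pi.single_eq_of_ne (show (0 : Fin 2) ≠ 1 by decide), Pi.single_eq_same, Pi.sub_apply]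
      simp only at hV0 ha0
      refine ⟨ha0.symm, ?_⟩
      rw [hV0]; ring
    · show assemble (topRel (W 1 - W 0) (lastStep W 0 tv) (arcPair W 0 tv w1).2 tv)
          (topRel (W (tv + 1) - W tv) (lastStep W tv (N - tv)) (arcPair W tv (N - tv) w2).2 (N - tv)) tv
          ((min m (N - 1) + N - tu) % N) -
        assemble (topRel (W 1 - W 0) (lastStep W 0 tv) (arcPair W 0 tv w1).2 tv)
          (topRel (W (tv + 1) - W tv) (lastStep W tv (N - tv)) (arcPair W tv (N - tv) w2).2 (N - tv)) tv
          ((0 + N - tu) % N) = υ m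
      rw [hRi, hRi, hV0]
      simp only [hVdef, cyc, Nat.mod_eq_of_lt (show min m (N - 1) < N by omega)]
      simp only at hυend ⊢
      rcases le_or_gt m (N - 1) with hm | hm
      · rw [min_eq_left hm]; abel
      · rw [min_eq_right hm.le, ← hυend m hm.le]; abel

/-- **The counting inequality (both walls).** For `T ≥ 1`,
`q̃_N(S_T) ≤ 26244 (T+1) N Σ_{ℓ ≤ N} c_{ℓ-2}(S_{T-1}) c_{N-ℓ-2}(S_{T-1})`.
[cite: MadrasSlade1993, Theorem 8.2.2 (b) (this file's proof: quantitative form)] -/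
theorem tubePolygonCount_le_sum_pred {T : ℕ} (hT : 1 ≤ T) (N : ℕ) :
    tubePolygonCount 2 1 T N ≤ N * ((T + 1) * ((2 * (9 * 9)) * ((2 * (9 * 9)) *
      ∑ ℓ ∈ Finset.range (N + 1), tubeCount 2 1 (T - 1) (ℓ - 2) * tubeCount 2 1 (T - 1) (N - ℓ - 2)))) := by
  classical
  rw [← card_codes2, tubePolygonCount]
  calc (tubePolygonPairs 2 1 T N).card ≤ ((codes2 T N).image (decode2 N)).card :=
        Finset.card_le_card fun p hp => by
          obtain ⟨c, hc, hcp⟩ := exists_code2 hT hp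
          exact Finset.mem_image.2 ⟨c, hc, hcp⟩
    _ ≤ (codes2 T N).card := Finset.card_image_le

/-! ### Analysis -/

/-- From `q̃_N ≤ C (N+1)² ρ^N` for all `N` to `π(S_T) ≤ ρ`. [folklore] -/
private theorem c_tubePolygonRate_le_of_le_mul_pow {T : ℕ} {C ρ : ℝ} (hρ : 0 < ρ)
    (h : ∀ N, (tubePolygonCount 2 1 T N : ℝ) ≤ C * ((N : ℝ) + 1) ^ 2 * ρ ^ N) :
    tubePolygonRate 2 1 T ≤ ρ := by
  unfold tubePolygonRate
  refine le_of_forall_gt_imp_ge_of_dense fun ρ' hρ' => ?_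
  have hρ'0 : 0 < ρ' := hρ.trans hρ'
  have hr : |ρ / ρ'| < 1 := by
    rw [abs_of_pos (div_pos hρ hρ'0), div_lt_one hρ'0]; exact hρ'
  have hlim : Tendsto (fun N : ℕ => |C| * 2 ^ 2 * ((N : ℝ) ^ 2 * (ρ / ρ') ^ N)) atTop (𝓝 0) := by
    have := (tendsto_pow_const_mul_const_pow_of_abs_lt_one 2 hr).const_mul (|C| * 2 ^ 2)
    rwa [mul_zero] at this
  have hev0 : ∀ᶠ n : ℕ in atTop, (tubePolygonCount 2 1 T n : ℝ) ≤ ρ' ^ n := by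
    filter_upwards [(tendsto_order.1 hlim).2 1 one_pos, eventually_ge_atTop 1] with N hN hN1
    have hbound : C * ((N : ℝ) + 1) ^ 2 * (ρ / ρ') ^ N ≤ 1 := by
      have hN1' : (1 : ℝ) ≤ N := by exact_mod_cast hN1
      have h2 : ((N : ℝ) + 1) ^ 2 ≤ (2 : ℝ) ^ 2 * (N : ℝ) ^ 2 := by
        rw [← mul_pow]; exact pow_le_pow_left₀ (by positivity) (by linarith) 2
      have hq : 0 ≤ (ρ / ρ') ^ N := by positivity
      calc C * ((N : ℝ) + 1) ^ 2 * (ρ / ρ') ^ N ≤ |C| * ((N : ℝ) + 1) ^ 2 * (ρ / ρ') ^ N := by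
            gcongr; exact le_abs_self C
        _ ≤ |C| * ((2 : ℝ) ^ 2 * (N : ℝ) ^ 2) * (ρ / ρ') ^ N := by gcongr
        _ = |C| * 2 ^ 2 * ((N : ℝ) ^ 2 * (ρ / ρ') ^ N) := by ring
        _ ≤ 1 := hN.le
    calc (tubePolygonCount 2 1 T N : ℝ) ≤ C * ((N : ℝ) + 1) ^ 2 * ρ ^ N := h N
      _ = (C * ((N : ℝ) + 1) ^ 2 * (ρ / ρ') ^ N) * ρ' ^ N := by rw [div_pow]; field_simp
      _ ≤ 1 * ρ' ^ N := mul_le_mul_of_nonneg_right hbound (by positivity)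
      _ = ρ' ^ N := one_mul _
  obtain ⟨n₀, hn₀⟩ := eventually_atTop.1 hev0
  have hev : ∀ᶠ N : ℕ in atTop,
      ((tubePolygonCount 2 1 T (2 * N + 2) : ℝ)) ^ (1 / (2 * (N : ℝ) + 2)) ≤ ρ' := by
    filter_upwards [eventually_ge_atTop n₀] with N hN
    have hn : (2 * (N : ℝ) + 2) = ((2 * N + 2 : ℕ) : ℝ) := by push_cast; ring
    calc ((tubePolygonCount 2 1 T (2 * N + 2) : ℝ)) ^ (1 / (2 * (N : ℝ) + 2))
        ≤ (ρ' ^ (2 * N + 2)) ^ (1 / (2 * (N : ℝ) + 2)) :=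
          Real.rpow_le_rpow (Nat.cast_nonneg _) (hn₀ _ (by omega)) (by positivity)
      _ = ρ' := by rw [hn, one_div, Real.pow_rpow_inv_natCast hρ'0.le (by omega)]
  exact Filter.limsup_le_of_le
    (Filter.isCoboundedUnder_le_of_le atTop fun N => Real.rpow_nonneg (Nat.cast_nonneg _) _) hev


/-- **The geometric bound (both walls).** For `ρ > μ(S_{T-1})`: `q̃_N(S_T) ≤ C (N+1)² ρ^N` for all `N`.
[cite: MadrasSlade1993, Theorem 8.2.2 (b) (this file's proof: quantitative form)] -/
theorem tubePolygonCount_le_mul_pow_pred {T : ℕ} (hT : 1 ≤ T) {ρ : ℝ} (hρ : tubeConnectiveConstant 2 1 (T - 1) < ρ) :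
    ∃ C : ℝ, ∀ N, (tubePolygonCount 2 1 T N : ℝ) ≤ C * ((N : ℝ) + 1) ^ 2 * ρ ^ N := by
  have hμ₀ : 1 ≤ tubeConnectiveConstant 2 1 (T - 1) := one_le_tubeConnectiveConstant (d := 2) le_rfl _
  have hρ1 : 1 ≤ ρ := by linarith
  obtain ⟨D, hD, hDb⟩ := CornerDecomp.exists_tubeCount_le_mul_pow (d := 2) le_rfl (T - 1) hρ
  refine ⟨26244 * ((T : ℝ) + 1) * D ^ 2, fun N => ?_⟩
  have hterm : ∀ ℓ ∈ Finset.range (N + 1),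
      ((tubeCount 2 1 (T - 1) (ℓ - 2) * tubeCount 2 1 (T - 1) (N - ℓ - 2) : ℕ) : ℝ) ≤ D ^ 2 * ρ ^ N := by
    intro ℓ hℓ
    rw [Finset.mem_range] at hℓ
    push_cast
    calc (tubeCount 2 1 (T - 1) (ℓ - 2) : ℝ) * tubeCount 2 1 (T - 1) (N - ℓ - 2)
        ≤ (D * ρ ^ (ℓ - 2)) * (D * ρ ^ (N - ℓ - 2)) :=
          mul_le_mul (hDb _) (hDb _) (Nat.cast_nonneg _) (by positivity)
      _ = D ^ 2 * ρ ^ (ℓ - 2 + (N - ℓ - 2)) := by rw [pow_add]; ring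
      _ ≤ D ^ 2 * ρ ^ N := by
          refine mul_le_mul_of_nonneg_left (pow_le_pow_right₀ hρ1 (by omega)) (by positivity)
  have hsum : (∑ ℓ ∈ Finset.range (N + 1),
      ((tubeCount 2 1 (T - 1) (ℓ - 2) * tubeCount 2 1 (T - 1) (N - ℓ - 2) : ℕ) : ℝ)) ≤ ((N : ℝ) + 1) * (D ^ 2 * ρ ^ N) := by
    calc (∑ ℓ ∈ Finset.range (N + 1), ((tubeCount 2 1 (T - 1) (ℓ - 2) * tubeCount 2 1 (T - 1) (N - ℓ - 2) : ℕ) : ℝ))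
        ≤ ∑ _ℓ ∈ Finset.range (N + 1), D ^ 2 * ρ ^ N := Finset.sum_le_sum hterm
      _ = ((N : ℝ) + 1) * (D ^ 2 * ρ ^ N) := by
          rw [Finset.sum_const, Finset.card_range, nsmul_eq_mul]; push_cast; ring
  have hc : (tubePolygonCount 2 1 T N : ℝ) ≤ N * ((T + 1) * ((2 * (9 * 9)) * ((2 * (9 * 9)) *
      ∑ ℓ ∈ Finset.range (N + 1), ((tubeCount 2 1 (T - 1) (ℓ - 2) * tubeCount 2 1 (T - 1) (N - ℓ - 2) : ℕ) : ℝ)))) := by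
    exact_mod_cast tubePolygonCount_le_sum_pred hT N
  have hN : (N : ℝ) ≤ (N : ℝ) + 1 := by linarith
  have hN0 : (0 : ℝ) ≤ N := Nat.cast_nonneg N
  calc (tubePolygonCount 2 1 T N : ℝ)
      ≤ N * ((T + 1) * ((2 * (9 * 9)) * ((2 * (9 * 9)) * (((N : ℝ) + 1) * (D ^ 2 * ρ ^ N))))) := by
        refine hc.trans ?_; gcongr
    _ = 26244 * ((T : ℝ) + 1) * D ^ 2 * ((N : ℝ) * ((N : ℝ) + 1)) * ρ ^ N := by ring
    _ ≤ 26244 * ((T : ℝ) + 1) * D ^ 2 * ((N : ℝ) + 1) ^ 2 * ρ ^ N := by gcongr; nlinarith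

end StripPolygonWall

/-! ### The theorems -/

section Theorems

open StripPolygonWall

/-- **Polygons in `S_T` versus walks in `S_{T-1}`: `π(S_T) ≤ μ(S_{T-1})`** for every `T ≥ 1` — the growth rate of
the self-avoiding polygons of the planar strip `ℤ × {0,…,T}` is at most the connective constant of the self-avoiding
WALKS of the thinner strip `ℤ × {0,…,T-1}`. (Each of the two arcs of a polygon between its extreme columns keeps off
one wall: topological shielding from both walls.)
[cite: MadrasSlade1993, Theorem 8.2.2 (b) (p. 271; this file proves the sharper comparison with the thinner strip)] -/
theorem tubePolygonRate_le_tubeConnectiveConstant_pred {T : ℕ} (hT : 1 ≤ T) :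
    tubePolygonRate 2 1 T ≤ tubeConnectiveConstant 2 1 (T - 1) := by
  refine le_of_forall_gt_imp_ge_of_dense fun ρ hρ => ?_
  have hρpos : 0 < ρ := (tubeConnectiveConstant_pos (d := 2) le_rfl _).trans hρ
  obtain ⟨C, hC⟩ := tubePolygonCount_le_mul_pow_pred hT hρ
  exact c_tubePolygonRate_le_of_le_mul_pow hρpos hC

/-- **The polygon deficit of a planar strip is at least the monotonicity gap of the walks:**
`log μ(S_T) - log π(S_T) ≥ log μ(S_T) - log μ(S_{T-1})` (`T ≥ 1`).
[cite: MadrasSlade1993, Theorem 8.2.2 (b) (p. 271; explicit deficit, this file)] -/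
theorem log_tubeConnectiveConstant_sub_log_tubePolygonRate_ge_gap {T : ℕ} (hT : 1 ≤ T) :
    Real.log (tubeConnectiveConstant 2 1 T) - Real.log (tubeConnectiveConstant 2 1 (T - 1)) ≤
      Real.log (tubeConnectiveConstant 2 1 T) - Real.log (tubePolygonRate 2 1 T) := by
  have hπ0 : 0 < tubePolygonRate 2 1 T := zero_lt_one.trans_le (TubePolygon.one_le_tubePolygonRate (d := 0) hT)
  have := Real.log_le_log hπ0 (tubePolygonRate_le_tubeConnectiveConstant_pred hT)
  linarith

end Theorems

end Literature.Probability.RandomPlanarGeometry.SAW.Zd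

end
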